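import Mathlib
import Summits.ResolutionOfSingularities.ResolutionOfSingularities.Theorems.WeightedInvariantLocalWeightedDropTOT2StepBlowOne
/-!
# TOT2-LINE (P3) B6 step (DIM-PREMISE VARIANT of res-L1-w43-stub-2's file: `hB4` carries `ringKrullDim (R₃ ⧸ P′) = 1`, as the landed bricks B4-1..4 do — res-L1-w43-lead-1 g6) 1/6: THE `u₁`-ORIGIN POINT ANSWER — the budget does not rise, and drops at a conflict

Sub-problem `ResolutionOfSingularities`, ENGINE crux `stmt-ResolutionOfSingularities-8899` (`LocalWeightedDrop`), skeleton v35 (2e806da509994632),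
registered stub `stub_conflictBudget` (P3); plan `L/res-L1-w43-stub-2/g6/B6-PLAN.md` §1.  [OURS · L1 W4.3 · chain w43 · res-L1-w43-stub-2 g6 (owner of
(P3)); def-free; the bricks B3 (chart invariance of `branchVal`, res-L1-w43-stub-1), B4-1 (downward transport, res-L1-w43-lead-1), D3 v2
(`pairVal_lt_top`) and the injectivity of `comap` are taken as HYPOTHESES in their typed-split form, to be discharged by name when they land;
nothing here is a statement of any manuscript; AI-produced, gate-checked, weaker than expert review.]

Successor: `A′ = blowOneT d A`, `N′ = insert 0 (N.filter (· = 1))`, chart `Φ` with `Φ f = f(u₁, u₁u₂, u₁y)`.  For every surviving branch `P′`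
(one-dimensional non-line top-locus prime of `A′`), `P = Φ⁻¹P′` is one of `A` (B4, B3), with `v_{P′}(u₁) = v_P(u₁)` and `v_{P′}(u₁) + v_{P′}(u₂) =
v_P(u₂)` (B3 + `Φ u₂ = u₁u₂`), the letter bit is unchanged (D6a), pairs drop (B6-pairs), and `row_chartOne` gives slack `β`; `budget_le` /
`budget_lt_of_slack` / `budget_lt_of_dying` (B6-comparison) conclude, the conflict branch of D5 supplying the strictness.
* `conflictBudgetD_blowOneT_le_of_dim`, `conflictBudgetD_blowOneT_lt_of_dim`.
-/

set_option linter.dupNamespace false -- mandated namespace of this single-conjunct summit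

noncomputable section

namespace Summit.ResolutionOfSingularities.ResolutionOfSingularities.Theorems

namespace TOT2Branch

open MvPowerSeries IsLocalRing PolyDescent Literature.AlgebraicGeometry.Resolution

variable {k : Type} [Field k]

/-! ## The step theorem -/

section Step

variable {d : ℕ} {A : Fin d → MvPowerSeries (Fin 2) k} {N N' : Finset (Fin 2)}
  (Φ : MvPowerSeries (Fin 3) k →ₐ[k] MvPowerSeries (Fin 3) k)

/-- **B6 STEP `u₁`-ORIGIN, WITH SLACK.**  Under the context for `(A, N)`, `InPoly d A`, and the bricks B3 / B4-1 / D3 / injectivity for the chart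
`Φ = (u₁, u₁u₂, u₁y)`: the budget of `(blowOneT d A, insert 0 (N.filter (· = 1)))` plus (the letter bit, if the conflict branch survives) is at
most the budget of `(A, N)` — packaged as: `M′ ≤ M`, and `M′ < M` whenever some non-line top-locus prime of `A` with positive charge either
dies or survives with `β = 1`.  Both laws below are corollaries. -/
theorem conflictBudgetD_blowOneT_le_of_dim (p : ℕ) [Fact p.Prime] [CharP k p] [IsAlgClosed k]
    (hΦ : ∀ f, Φ f = subst (![X 0, X 0 * X 1, X 0 * X 2] : Fin 3 → MvPowerSeries (Fin 3) k) f)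
    (hB3 : ∀ (P' : Ideal (MvPowerSeries (Fin 3) k)) [P'.IsPrime], ringKrullDim (MvPowerSeries (Fin 3) k ⧸ P') = 1 →
      (X 0 : MvPowerSeries (Fin 3) k) ∉ P' →
      ringKrullDim (MvPowerSeries (Fin 3) k ⧸ P'.comap Φ) = 1 ∧ ∀ f, branchVal (P'.comap Φ) f = branchVal P' (Φ f))
    (hB4 : ∀ (P' : Ideal (MvPowerSeries (Fin 3) k)), P' ∈ topPrimes d (blowOneT d A) → (X 0 : MvPowerSeries (Fin 3) k) ∉ P' →
      ringKrullDim (MvPowerSeries (Fin 3) k ⧸ P') = 1 → P'.comap Φ ∈ topPrimes d A)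
    (hD3 : ∀ (P Q : Ideal (MvPowerSeries (Fin 3) k)), P ∈ topPrimes d A → Q ∈ topPrimes d A → P ≠ Q →
      ringKrullDim (MvPowerSeries (Fin 3) k ⧸ P) = 1 → ringKrullDim (MvPowerSeries (Fin 3) k ⧸ Q) = 1 → pairVal P Q < ⊤)
    (hinj : ∀ (P' Q' : Ideal (MvPowerSeries (Fin 3) k)), P'.IsPrime → Q'.IsPrime → ringKrullDim (MvPowerSeries (Fin 3) k ⧸ P') = 1 →
      ringKrullDim (MvPowerSeries (Fin 3) k ⧸ Q') = 1 → (X 0 : MvPowerSeries (Fin 3) k) ∉ P' → (X 0 : MvPowerSeries (Fin 3) k) ∉ Q' →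
      P'.comap Φ = Q'.comap Φ → P' = Q')
    (hctx : ∃ (b : MvPowerSeries (Fin (2 + 1)) k) (δ : TameFourTupleDrop.Decoration k 2) (Θ : Fin (2 + 1) → MvPowerSeries (Fin (2 + 1)) k),
      TameFourTupleDrop.Admissible b δ ∧ 2 ≤ δ.o ∧ δ.c = d ∧ δ.PresBy d A N Θ)
    (hin : InPoly d A) (hN' : N' = insert 0 (N.filter fun l => l = 1)) :
    conflictBudgetD d (blowOneT d A) N' ≤ conflictBudgetD d A N ∧
      ∀ P₀ ∈ topPrimesDNL d A, 1 ≤ betaTwo d A N →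
        conflictBudgetD d (blowOneT d A) N' < conflictBudgetD d A N := by
  classical
  have hd2 : 2 ≤ d := NCBranchPrimes.two_le_of_presContext hctx
  have hsq : Squarefree (NCPoly.monicGerm d A) := NCBranchPrimes.squarefree_monicGerm_of_presContext hctx
  set A' := blowOneT d A with hA'
  -- the chart on variables and on plane series
  have hs : HasSubst (![X 0, X 0 * X 1, X 0 * X 2] : Fin 3 → MvPowerSeries (Fin 3) k) :=
    hasSubst_of_constantCoeff_zero fun i => by fin_cases i <;> simp
  have hΦX0 : Φ (X 0) = X 0 := by rw [hΦ, subst_X hs]; rfl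
  have hΦX1 : Φ (X 1) = X 0 * X 1 := by rw [hΦ, subst_X hs]; rfl
  have hΦ₂ : ∀ g : MvPowerSeries (Fin 2) k, Φ (toThree g) = toThree (subst (![X 0, X 0 * X 1] : Fin 2 → MvPowerSeries (Fin 2) k) g) := by
    intro g
    rw [hΦ, toThree]
    exact subst_rename_eq_rename_subst _ (fun i => by fin_cases i <;> simp) _ (fun i => by fin_cases i <;> simp)
      (fun i => by fin_cases i <;> simp [rename_X, map_mul, succAbove_two_one]) g
  -- the index sets
  have hfinS : (topPrimesDNL d A).Finite := (topPrimesNL_finite p hctx).subset (topPrimesDNL_subset_topPrimesNL d A)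
  set ι : Ideal (MvPowerSeries (Fin 3) k) → Ideal (MvPowerSeries (Fin 3) k) := fun P' => P'.comap Φ with hιdef
  have hιmem : ∀ P' ∈ topPrimesDNL d A', ι P' ∈ topPrimesDNL d A := by
    intro P' hP'
    obtain ⟨⟨hP'top, hdim'⟩, hX0', hX1'⟩ := hP'
    haveI := hP'top.1
    obtain ⟨hdim, -⟩ := hB3 P' hdim' hX0'
    refine ⟨⟨hB4 P' hP'top hX0' hdim', hdim⟩, ?_, ?_⟩
    · rw [hιdef, Ideal.mem_comap]; show Φ (X 0) ∉ P'; rw [hΦX0]; exact hX0'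
    · rw [hιdef, Ideal.mem_comap]; show Φ (X 1) ∉ P'; rw [hΦX1]
      exact fun h => (hP'top.1.mem_or_mem h).elim hX0' hX1'
  have hinjOn : Set.InjOn ι (topPrimesDNL d A') := by
    intro P' hP' Q' hQ' h
    exact hinj P' Q' hP'.1.1.1 hQ'.1.1.1 hP'.1.2 hQ'.1.2 hP'.2.1 hQ'.2.1 h
  have hfinS' : (topPrimesDNL d A').Finite :=
    Set.Finite.of_finite_image (hfinS.subset (fun P hP => by obtain ⟨P', hP', rfl⟩ := hP; exact hιmem P' hP')) hinjOn
  set S := hfinS.toFinset with hSdef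
  set S' := hfinS'.toFinset with hS'def
  have hmemS : ∀ {P}, P ∈ S ↔ P ∈ topPrimesDNL d A := fun {P} => Set.Finite.mem_toFinset _
  have hmemS' : ∀ {P'}, P' ∈ S' ↔ P' ∈ topPrimesDNL d A' := fun {P'} => Set.Finite.mem_toFinset _
  -- the letter bit is unchanged
  have hβ : betaTwo d A' N' = betaTwo d A N := by
    refine betaTwo_congr ?_
    rw [hN', hA', isPermissibleTwoT_blowOneT_iff hin.2.1]
    simp
  -- per-branch facts
  have hvals : ∀ P' ∈ topPrimesDNL d A',
      branchVal P' (X 0) ≠ ⊤ ∧ branchVal P' (X 1) ≠ ⊤ ∧ 1 ≤ branchVal P' (X 0) ∧ 1 ≤ branchVal P' (X 1) ∧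
      branchVal P' (X 0) = branchVal (ι P') (X 0) ∧ branchVal P' (X 0) + branchVal P' (X 1) = branchVal (ι P') (X 1) := by
    intro P' hP'
    obtain ⟨⟨hP'top, hdim'⟩, hX0', hX1'⟩ := hP'
    haveI := hP'top.1
    obtain ⟨-, hval⟩ := hB3 P' hdim' hX0'
    refine ⟨(branchVal_eq_top_iff_of_dim hdim' _).not.mpr hX0', (branchVal_eq_top_iff_of_dim hdim' _).not.mpr hX1',
      one_le_branchVal_X_of_dim hdim' 0, one_le_branchVal_X_of_dim hdim' 1, ?_, ?_⟩
    · rw [hιdef]; show branchVal P' (X 0) = branchVal (P'.comap Φ) (X 0); rw [hval, hΦX0]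
    · rw [hιdef]; show _ = branchVal (P'.comap Φ) (X 1); rw [hval, hΦX1, branchVal_mul_of_dim hdim']
  -- charges with slack `β`
  have hc : ∀ P' ∈ S', charge d A' N' P' + betaTwo d A N ≤ charge d A N (ι P') +
      2 * ∑ Q ∈ S.filter (fun Q => Q ∉ S'.image ι), ((pairVal (ι P') Q).toNat + (pairVal Q (ι P')).toNat) := by
    intro P' hP'
    obtain ⟨ha', hb', h1a, h1b, haa, hbb⟩ := hvals P' (hmemS'.mp hP')
    exact le_add_right (charge_chartOne_le hβ ha' hb' h1a h1b haa hbb)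
  -- surviving pairs do not increase
  have hq : ∀ P' ∈ S', ∀ Q' ∈ S', P' ≠ Q' → (pairVal P' Q').toNat ≤ (pairVal (ι P') (ι Q')).toNat := by
    intro P' hP' Q' hQ' hne
    have hP'm := hmemS'.mp hP'
    have hQ'm := hmemS'.mp hQ'
    haveI := hP'm.1.1.1
    haveI := hQ'm.1.1.1
    obtain ⟨-, hval⟩ := hB3 P' hP'm.1.2 hP'm.2.1
    have hle : pairVal P' Q' + branchVal P' (X 0) ≤ pairVal (ι P') (ι Q') :=
      pairVal_add_le_of_transport Φ.toRingHom (subst (![X 0, X 0 * X 1] : Fin 2 → MvPowerSeries (Fin 2) k)) hΦ₂ hP'm.1.2 rfl rfl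
        (fun f => (hval f).symm ▸ rfl) (X 0) hQ'm.2.1 fun g hg0 => by
          obtain ⟨ĝ, hĝ⟩ := exists_chartOne_eq_mul hg0
          exact ⟨ĝ, by rw [hĝ, map_mul, toThree_X]; rfl⟩
    have hιne : ι P' ≠ ι Q' := fun h => hne (hinjOn hP'm hQ'm h)
    have hfin : pairVal (ι P') (ι Q') < ⊤ :=
      hD3 _ _ (hιmem P' hP'm).1.1 (hιmem Q' hQ'm).1.1 hιne (hιmem P' hP'm).1.2 (hιmem Q' hQ'm).1.2
    exact ENat.toNat_le_toNat (le_trans le_self_add hle) hfin.ne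
  -- the comparison
  have hιS : ∀ P' ∈ S', ι P' ∈ S := fun P' hP' => hmemS.mpr (hιmem P' (hmemS'.mp hP'))
  have hinjS : Set.InjOn ι S' := fun P' hP' Q' hQ' h => hinjOn (hmemS'.mp hP') (hmemS'.mp hQ') h
  have hmain := budget_comparison S' S ι hιS hinjS (charge d A' N') (fun _ => betaTwo d A N) (charge d A N)
    (fun P' Q' => (pairVal P' Q').toNat) (fun P Q => (pairVal P Q).toNat) hq hc
  rw [conflictBudgetD_eq_sum hfinS' N', conflictBudgetD_eq_sum hfinS N, ← hSdef, ← hS'def]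
  refine ⟨by omega, fun P₀ hP₀ hβ1 => ?_⟩
  -- strictness: `P₀` dies (charge ≥ 2 freed) or survives (slack `β ≥ 1`)
  by_cases hsurv : ∃ P' ∈ S', ι P' = P₀
  · obtain ⟨P', hP', -⟩ := hsurv
    have h1 : betaTwo d A N ≤ ∑ P' ∈ S', betaTwo d A N :=
      Finset.single_le_sum (f := fun _ => betaTwo d A N) (fun _ _ => Nat.zero_le _) hP'
    omega
  · push Not at hsurv
    have hP₀S : P₀ ∈ S := hmemS.mpr hP₀
    have hmem : P₀ ∈ S.filter (fun Q => Q ∉ S'.image ι) := mem_filter_not_mem_image.mpr ⟨hP₀S, hsurv⟩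
    have h1 : charge d A N P₀ ≤ ∑ Q ∈ S.filter (fun Q => Q ∉ S'.image ι), charge d A N Q :=
      Finset.single_le_sum (fun _ _ => Nat.zero_le _) hmem
    have h2 : 2 ≤ charge d A N P₀ := two_le_charge p hd2 hsq (topPrimesDNL_subset_topPrimesNL d A hP₀) N
    omega

/-- **B6 STEP `u₁`-ORIGIN: the conf-law at the `u₁`-origin** — at a conflict state the budget DROPS (the conflict branch of D5 is in `topPrimesDNL`
with `β = 1`). -/
theorem conflictBudgetD_blowOneT_lt_of_dim (p : ℕ) [Fact p.Prime] [CharP k p] [IsAlgClosed k]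
    (hΦ : ∀ f, Φ f = subst (![X 0, X 0 * X 1, X 0 * X 2] : Fin 3 → MvPowerSeries (Fin 3) k) f)
    (hB3 : ∀ (P' : Ideal (MvPowerSeries (Fin 3) k)) [P'.IsPrime], ringKrullDim (MvPowerSeries (Fin 3) k ⧸ P') = 1 →
      (X 0 : MvPowerSeries (Fin 3) k) ∉ P' →
      ringKrullDim (MvPowerSeries (Fin 3) k ⧸ P'.comap Φ) = 1 ∧ ∀ f, branchVal (P'.comap Φ) f = branchVal P' (Φ f))
    (hB4 : ∀ (P' : Ideal (MvPowerSeries (Fin 3) k)), P' ∈ topPrimes d (blowOneT d A) → (X 0 : MvPowerSeries (Fin 3) k) ∉ P' →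
      ringKrullDim (MvPowerSeries (Fin 3) k ⧸ P') = 1 → P'.comap Φ ∈ topPrimes d A)
    (hD3 : ∀ (P Q : Ideal (MvPowerSeries (Fin 3) k)), P ∈ topPrimes d A → Q ∈ topPrimes d A → P ≠ Q →
      ringKrullDim (MvPowerSeries (Fin 3) k ⧸ P) = 1 → ringKrullDim (MvPowerSeries (Fin 3) k ⧸ Q) = 1 → pairVal P Q < ⊤)
    (hinj : ∀ (P' Q' : Ideal (MvPowerSeries (Fin 3) k)), P'.IsPrime → Q'.IsPrime → ringKrullDim (MvPowerSeries (Fin 3) k ⧸ P') = 1 →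
      ringKrullDim (MvPowerSeries (Fin 3) k ⧸ Q') = 1 → (X 0 : MvPowerSeries (Fin 3) k) ∉ P' → (X 0 : MvPowerSeries (Fin 3) k) ∉ Q' →
      P'.comap Φ = Q'.comap Φ → P' = Q')
    (hctx : ∃ (b : MvPowerSeries (Fin (2 + 1)) k) (δ : TameFourTupleDrop.Decoration k 2) (Θ : Fin (2 + 1) → MvPowerSeries (Fin (2 + 1)) k),
      TameFourTupleDrop.Admissible b δ ∧ 2 ≤ δ.o ∧ δ.c = d ∧ δ.PresBy d A N Θ)
    (hin : InPoly d A) (hconf : NCPoly.Conflict d A N) (hN' : N' = insert 0 (N.filter fun l => l = 1)) :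
    conflictBudgetD d (blowOneT d A) N' < conflictBudgetD d A N := by
  have hd2 : 2 ≤ d := NCBranchPrimes.two_le_of_presContext hctx
  have hsq : Squarefree (NCPoly.monicGerm d A) := NCBranchPrimes.squarefree_monicGerm_of_presContext hctx
  obtain ⟨P₀, hP₀, -⟩ := exists_transverse_of_conflict p hctx hin hconf
  have hP₀D : P₀ ∈ topPrimesDNL d A := mem_topPrimesDNL_of_mem_topPrimesNL hP₀ (ringKrullDim_eq_one_of_mem_topPrimes p hd2 hsq hP₀.1)
  have hβ1 : 1 ≤ betaTwo d A N := by rw [(betaTwo_eq_one_iff).mpr (Or.inl hconf.2.2.2)]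
  exact (conflictBudgetD_blowOneT_le_of_dim Φ p hΦ hB3 hB4 hD3 hinj hctx hin hN').2 P₀ hP₀D hβ1

end Step

end TOT2Branch

end Summit.ResolutionOfSingularities.ResolutionOfSingularities.Theorems

end
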